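import Literature.Computability.AlgebraicComplexity.SymmetricArithCircuit
import Mathlib.Data.Fintype.Sum
import Mathlib.Logic.Embedding.Basic
import Mathlib.Logic.Equiv.Sum
import HarnessLib

/-!
# Symmetric circuits: pulling an output family back along an equivariant index map

Topic `Computability/AlgebraicComplexity`, namespace `Literature.Computability.AlgebraicComplexity`.

A closure property of Dawar–Wilsenach symmetric arithmetic circuits
(`SymmetricArithCircuit.lean`: `LabelledArithCircuit` = Def. 2.2, `IsAutomorphismExtending` =
Def. 3.6, `IsSymmetric` = Def. 3.7 of A. Dawar, G. Wilsenach, *Symmetric Arithmetic Circuits*,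
Theory of Computing 21 (2025)): if a `Γ`-symmetric labelled circuit `C` over the constants `K`
and the variables `X` computes the family `(g_y)_{y ∈ Y}` at outputs indexed by the `Γ`-set `Y`,
and `e : Y' → Y` is a `Γ`-EQUIVARIANT map from another `Γ`-set `Y'` (`e (γ • y') = γ • e y'`;
not necessarily injective), then the pulled-back family `(g_{e y'})_{y' ∈ Y'}` is computed at
outputs indexed by `Y'` by a `Γ`-symmetric labelled circuit on exactly `|G| + |Y'|` gates
(`LabelledArithCircuit.IsSymmetric.exists_pullback`). The point is that the output gates of a
labelled circuit are INJECTIVELY indexed (Def. 2.2 with outputs, Anderson–Dawar Def. 4), so an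
output family cannot simply be re-indexed along a non-injective `e` (e.g. viewing an `n`-indexed
family as an `n × n`-indexed one constant along rows, `(i, j) ↦ g_i`): each new index gets its
own COPY gate. This is one of the bookkeeping closure properties behind "symmetrically computable
families are closed under the algebraic operations" (Dawar–Wilsenach, remark after Def. 3.7).

Construction (`LabelledArithCircuit.Pullback.pullbackCircuit C e`, a post-composition gadget):
gate set `G ⊕ Y'`; an old gate `Sum.inl g` keeps its label and its wires (`pbWires`, `pbLabel`);
the new gate `Sum.inr y'` is a unary ADDITION gate whose single child is (the copy of) the output
gate of `C` indexed `e y'`, so that its value is `g_{e y'}` (`pullbackCircuit_eval_output`,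
`Finset.sum_singleton`), and it is the output gate indexed `y'`. No input gate is added, so the
clause "distinct input gates have distinct labels" of Def. 2.2 is inherited from `C`. An
automorphism `π` of `C` extending `γ` (Def. 3.6) extends as `π ⊕ (γ • ·)` (`Equiv.sumCongr`,
`pullbackCircuit_isAutomorphismExtending`): the child of `Sum.inr (γ • y')` is
`Sum.inl (out (e (γ • y'))) = Sum.inl (out (γ • e y')) = Sum.inl (π (out (e y')))` by
equivariance of `e` and `output_smul`. Everything is folklore and proved; nothing here is a
named fact.
-/

noncomputable section

namespace Literature.Computability.AlgebraicComplexity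

open MvPolynomial

universe u v w z z'

namespace LabelledArithCircuit

namespace Pullback

variable {K : Type u} {X : Type v} {Y : Type z} {Y' : Type z'} {G : Type w}
  (C : LabelledArithCircuit K X Y G) (e : Y' → Y)

/-! ### The construction -/

/-- Wires of the pull-back circuit: an old gate `Sum.inl g` keeps its children; the new copy
gate `Sum.inr y'` has the single child `Sum.inl (C.output (e y'))`.
[cite: DawarWilsenach2025, Def. 2.2] -/
def pbWires : G ⊕ Y' → Finset (G ⊕ Y')
  | .inl g => (C.children g).map Function.Embedding.inl
  | .inr y' => {Sum.inl (C.output (e y'))}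

variable (Y') in
/-- Labels of the pull-back circuit: old gates keep their labels, the new copy gates are (unary)
addition gates. [cite: DawarWilsenach2025, Def. 2.2] -/
def pbLabel : G ⊕ Y' → CircuitLabel K X
  | .inl g => C.label g
  | .inr _ => .add

/-- Wires of an old gate. [cite: DawarWilsenach2025, Def. 2.2] -/
theorem pbWires_inl (g : G) :
    pbWires C e (.inl g) = (C.children g).map Function.Embedding.inl := rfl

/-- The single wire into the copy gate `y'` comes from the output gate of `C` indexed `e y'`.
[cite: DawarWilsenach2025, Def. 2.2] -/
theorem pbWires_inr (y' : Y') :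
    pbWires C e (.inr y') = {Sum.inl (C.output (e y'))} := rfl

/-! #### Acyclicity -/

/-- Old gates are accessible (acyclicity of `C`). [cite: DawarWilsenach2025, Def. 2.2] -/
theorem acc_pbWires_inl (g : G) : Acc (fun s t : G ⊕ Y' => s ∈ pbWires C e t) (.inl g) := by
  induction g using C.wf.induction with
  | h g ih =>
    refine Acc.intro _ fun s hs => ?_
    simp only [pbWires, Finset.mem_map, Function.Embedding.inl_apply] at hs
    obtain ⟨h, hh, rfl⟩ := hs
    exact ih h hh

/-- Copy gates are accessible (their child is an old gate). [cite: DawarWilsenach2025, Def. 2.2] -/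
theorem acc_pbWires_inr (y' : Y') : Acc (fun s t : G ⊕ Y' => s ∈ pbWires C e t) (.inr y') := by
  refine Acc.intro _ fun s hs => ?_
  simp only [pbWires, Finset.mem_singleton] at hs
  subst hs
  exact acc_pbWires_inl C e _

/-- The child relation of the pull-back circuit is well founded.
[cite: DawarWilsenach2025, Def. 2.2] -/
theorem pbWires_wf : WellFounded fun s t : G ⊕ Y' => s ∈ pbWires C e t :=
  ⟨fun s => match s with
    | .inl g => acc_pbWires_inl C e g
    | .inr y' => acc_pbWires_inr C e y'⟩

/-! #### The labelled circuit -/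

/-- Input labels exactly at the gates without wires into them (the copy gates are internal and
have a child). [cite: DawarWilsenach2025, Def. 2.2] -/
theorem isInput_pbLabel_iff (s : G ⊕ Y') : (pbLabel Y' C s).IsInput ↔ pbWires C e s = ∅ := by
  cases s with
  | inl g => simp only [pbLabel, pbWires, Finset.map_eq_empty]; exact C.isInput_iff g
  | inr y' => simp [pbLabel, pbWires]

/-- Labels are injective on input gates: all input gates are old gates, on which this is the
corresponding clause for `C`. [cite: DawarWilsenach2025, Def. 2.2] -/
theorem eq_of_pbLabel_eq (s t : G ⊕ Y') (hs : (pbLabel Y' C s).IsInput)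
    (hst : pbLabel Y' C s = pbLabel Y' C t) : s = t := by
  cases s with
  | inl g =>
    change (C.label g).IsInput at hs
    cases t with
    | inl g' => exact congrArg Sum.inl (C.eq_of_label_eq g g' hs hst)
    | inr y' =>
      change C.label g = CircuitLabel.add at hst
      rw [hst] at hs
      exact absurd hs CircuitLabel.not_isInput_add
  | inr y' => exact absurd hs CircuitLabel.not_isInput_add

/-- **The pull-back circuit** of `C` along `e : Y' → Y` (module docstring): gate set `G ⊕ Y'`, the
old gates with their labels and wires, and one new unary addition (copy) gate `Sum.inr y'` per new
index, over the output gate of `C` indexed `e y'`; it is the output gate indexed `y'`.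
[cite: DawarWilsenach2025, Def. 2.2] -/
def pullbackCircuit : LabelledArithCircuit K X Y' (G ⊕ Y') where
  children := pbWires C e
  label := pbLabel Y' C
  output := Sum.inr
  wf := pbWires_wf C e
  isInput_iff := isInput_pbLabel_iff C e
  eq_of_label_eq := eq_of_pbLabel_eq C
  output_injective := Sum.inr_injective

/-! ### Semantics -/

section Eval

variable [CommSemiring K]

/-- Old gates keep their values. [cite: DawarWilsenach2025, §2 (evaluation)] -/
theorem pullbackCircuit_eval_inl (g : G) : (pullbackCircuit C e).eval (.inl g) = C.eval g := by
  induction g using C.wf.induction with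
  | h g ih =>
    have hlab : (pullbackCircuit C e).label (.inl g) = C.label g := rfl
    have hch : (pullbackCircuit C e).children (.inl g) =
        (C.children g).map Function.Embedding.inl := rfl
    rcases hg : C.label g with x | c | _ | _
    · rw [C.eval_of_label_var hg, (pullbackCircuit C e).eval_of_label_var (hlab.trans hg)]
    · rw [C.eval_of_label_const hg, (pullbackCircuit C e).eval_of_label_const (hlab.trans hg)]
    · rw [C.eval_of_label_add hg, (pullbackCircuit C e).eval_of_label_add (hlab.trans hg), hch,
        Finset.sum_map]
      exact Finset.sum_congr rfl fun h hh => ih h hh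
    · rw [C.eval_of_label_mul hg, (pullbackCircuit C e).eval_of_label_mul (hlab.trans hg), hch,
        Finset.prod_map]
      exact Finset.prod_congr rfl fun h hh => ih h hh

/-- A copy gate takes the value of `C` at the output indexed `e y'` (a unary sum).
[cite: DawarWilsenach2025, §2 (evaluation)] -/
theorem pullbackCircuit_eval_inr (y' : Y') :
    (pullbackCircuit C e).eval (.inr y') = C.eval (C.output (e y')) := by
  rw [(pullbackCircuit C e).eval_of_label_add
    (show (pullbackCircuit C e).label (.inr y') = .add from rfl)]
  change ∑ h ∈ ({Sum.inl (C.output (e y'))} : Finset (G ⊕ Y')), (pullbackCircuit C e).eval h = _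
  rw [Finset.sum_singleton, pullbackCircuit_eval_inl]

/-- **Semantics.** The output indexed `y'` computes the value of `C` at its output indexed `e y'`:
the pull-back circuit computes the pulled-back family `(g_{e y'})_{y'}`.
[cite: DawarWilsenach2025, §2 (evaluation)] -/
theorem pullbackCircuit_eval_output (y' : Y') :
    (pullbackCircuit C e).eval ((pullbackCircuit C e).output y') = C.eval (C.output (e y')) :=
  pullbackCircuit_eval_inr C e y'

end Eval

/-! ### Symmetry -/

section Symmetry

variable {C e} {Γ : Type*} [Group Γ] [MulAction Γ X] [MulAction Γ Y] [MulAction Γ Y'] {γ : Γ}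
  {π : Equiv.Perm G}

/-- **Symmetry.** If `π` is an automorphism of `C` extending `γ` and `e` commutes with `γ`, then
`π ⊕ (γ • ·)` is an automorphism of the pull-back circuit extending `γ`: the child
`out (e y')` of the copy gate `y'` goes to `π (out (e y')) = out (γ • e y') = out (e (γ • y'))`,
the child of the copy gate `γ • y'`. [cite: DawarWilsenach2025, Def. 3.6] -/
theorem pullbackCircuit_isAutomorphismExtending (hπ : C.IsAutomorphismExtending γ π)
    (he : ∀ y' : Y', e (γ • y') = γ • e y') :
    (pullbackCircuit C e).IsAutomorphismExtending γ (Equiv.sumCongr π (MulAction.toPerm γ)) := by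
  refine ⟨?_, ?_, fun _ => rfl⟩
  · rintro (g | y')
    · change pbWires C e (.inl (π g)) =
        (pbWires C e (.inl g)).map (Equiv.sumCongr π (MulAction.toPerm γ)).toEmbedding
      rw [pbWires_inl, pbWires_inl, hπ.children_apply, Finset.map_map, Finset.map_map]
      rfl
    · change pbWires C e (.inr (γ • y')) =
        (pbWires C e (.inr y')).map (Equiv.sumCongr π (MulAction.toPerm γ)).toEmbedding
      rw [pbWires_inr, pbWires_inr, Finset.map_singleton, he, hπ.output_smul]
      rfl
  · rintro (g | y')
    · exact hπ.label_apply g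
    · rfl

/-- A `Γ`-symmetric `C` and a `Γ`-equivariant `e` give a `Γ`-symmetric pull-back circuit
(Def. 3.7). [cite: DawarWilsenach2025, Def. 3.7] -/
theorem pullbackCircuit_isSymmetric (hC : C.IsSymmetric Γ)
    (he : ∀ (γ : Γ) (y' : Y'), e (γ • y') = γ • e y') : (pullbackCircuit C e).IsSymmetric Γ := by
  intro γ
  obtain ⟨π, hπ⟩ := hC γ
  exact ⟨Equiv.sumCongr π (MulAction.toPerm γ), pullbackCircuit_isAutomorphismExtending hπ (he γ)⟩

end Symmetry

end Pullback

/-- **Pull-back of a symmetrically computed family along an equivariant index map.** For any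
group `Γ` acting on the variables `X` and on the index sets `Y`, `Y'`: if a `Γ`-symmetric labelled
circuit `C` over `K`, `X` computes `(g_y)_{y ∈ Y}` at outputs indexed by `Y` and `e : Y' → Y` is
`Γ`-equivariant (not necessarily injective), then some `Γ`-symmetric labelled circuit with outputs
indexed by `Y'` computes at `y'` the value of `C` at `e y'`, on at most `|G| + |Y'|` gates
(Dawar–Wilsenach Defs. 2.2, 3.6, 3.7; the construction is `Pullback.pullbackCircuit`, one unary
`+` copy gate per new index — needed because output gates are injectively indexed — and the size
is that of `G ⊕ Y'`). [cite: DawarWilsenach2025, Def. 3.7] -/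
theorem IsSymmetric.exists_pullback {K : Type u} [CommSemiring K] {X : Type v} {Y : Type z}
    {Y' : Type z'} [Fintype Y'] {G : Type w} [Fintype G] {Γ : Type*} [Group Γ] [MulAction Γ X]
    [MulAction Γ Y] [MulAction Γ Y'] {C : LabelledArithCircuit K X Y G} (hC : C.IsSymmetric Γ)
    (e : Y' → Y) (he : ∀ (γ : Γ) (y' : Y'), e (γ • y') = γ • e y') :
    ∃ (G' : Type (max w z')) (_ : Fintype G') (C' : LabelledArithCircuit K X Y' G'),
      C'.IsSymmetric Γ ∧
      (∀ y', C'.eval (C'.output y') = C.eval (C.output (e y'))) ∧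
      Fintype.card G' ≤ Fintype.card G + Fintype.card Y' :=
  ⟨G ⊕ Y', inferInstance, Pullback.pullbackCircuit C e, Pullback.pullbackCircuit_isSymmetric hC he,
    Pullback.pullbackCircuit_eval_output C e, Fintype.card_sum.le⟩

end LabelledArithCircuit

end Literature.Computability.AlgebraicComplexity

end
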